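import Literature.NumberTheory.LFunctions.ImaginaryQuadraticGrossencharakterLSeries
import HarnessLib

/-!
# The g-side of Hecke's functional equation for a Größencharakter of type `(m, 0)` of an imaginary quadratic field:
# the dual Mellin transforms, the Gauss sum, and the partial `L`-series of `χ̄` (Neukirch VII (8.4)–(8.5) with (6.4), (7.7))

Topic `Literature/NumberTheory/LFunctions`; namespace `Literature.NumberTheory.LFunctions`.  Sequel of
`ImaginaryQuadraticGrossencharakterLSeries.lean` (the f-side); port of the §GSide of `RayClassFunctionalEquation.lean`
(sign types) to the harmonic weight `σ^m`.  Everything is PROVED; no named fact, no definition.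

Setting as in the f-side file: `K` with a complex place `w` and `[K:ℚ] = 2`, `σ = σ_w`, `𝔪 ≠ 0`, `ψ` with
`HasEmbPowType 𝔪 σ m ψ`, PRIMITIVE (`IsPrimitiveGross 𝔪 ψ σ m`), `m ≥ 1`.  Class data (Neukirch's, in the coset language of
VII §8 Remark 1): an integral `𝔟 ≠ 0`, `b₀ ∈ 𝔟`; an integral `𝔟' ≠ 0` prime to `𝔪`, `x₁ ∈ 𝔟'`, `x₁ ≡ 1 mod 𝔪`; `β ≠ 0` with
`𝔟𝔟'𝔪𝔡 = (β)`; `y₁ = b₀x₁/β ∈ 𝔪⁻¹𝔡⁻¹`.  Then (`dual_coeIdeal_mul_eq_of_span_eq`) `(𝔪𝔟)^∨ = β⁻¹𝔟' =: B` and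
`𝔟^∨ = β⁻¹𝔪𝔟' =: C`, `B/C ≅ 𝒪/𝔪` with representatives `c_ρ = β⁻¹ r_ρ x₁`.

* `sum_grossFinitePart_mul_symm_Λ_eq` — **the g-side per ideal class**: for the strong FE-pairs `P_q = heckeThetaPairC` of the
  cosets `r_q b₀ + 𝔪𝔟` and `re s > m/2 + 1`,
  `Σ_q χ_f(r_q) Λ̂_{P_q}(s) = (2π)^{-s} Γ(s) τ_𝔪(χ_f, y₁) h₀ (conj σ(β)^m)⁻¹ |N(β)|^s χ̄(𝔟') 𝔑(𝔟')^{-s} Σ_{𝔞 ∈ [𝔟']⁻¹} χ̄'(𝔞) 𝔑(𝔞)^{-s}`.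
  Steps: (G1) the dual sum `Σ_{b ∈ B∖0} e^{2πi Tr(a₀ b)} conj(σb)^m |Nb|^{-s}` (`heckeThetaPairC_symm_Λ_eq`) is decomposed along
  the cosets `c_ρ + C` of `B` (`Tr(a₀ C) ⊆ ℤ` for `a₀ ∈ 𝔟`); (G2) "we recognize the sum in question as the Gauss sum"
  `Σ_q χ_f(r_q) e^{2πi Tr(r_q r_ρ y₁)} = τ(r_ρ y₁) = χ̄_f(r_ρ) τ(y₁)` (VII (6.4), `grossGaussSum_mul_eq`); (G3) recombination over
  `B ∖ 0 = β⁻¹(𝔟' ∖ 0)` and `χ̄_f(b') conj σ(b')^m = χ̄'((b'))`, `(b') = 𝔞𝔟'` (`RayClassOrbitSums`).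

## References

* J. Neukirch, *Algebraic Number Theory*, Grundlehren 322, Springer 1999, Ch. VII §8 (8.4)–(8.5), §7 (7.7), §6 (6.4) and §8
  Remark 1. [NeukirchANT1999]
* E. Hecke, Math. Z. 6 (1920), 11–51. [HeckeMathZ1920]
-/

noncomputable section

open scoped FourierTransform nonZeroDivisors ComplexConjugate Real
open NumberField NumberField.InfinitePlace IsDedekindDomain Complex
open Literature.NumberTheory.GaloisRepresentations

namespace Literature.NumberTheory.LFunctions

variable {K : Type*} [Field K] [NumberField K]

open scoped Classical

section GSide

variable (w : {w : InfinitePlace K // IsComplex w}) (h2 : Module.finrank ℚ K = 2)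
  {𝔪 : Ideal (𝓞 K)} {ψ : HeightOneSpectrum (𝓞 K) → ℂ} {m : ℕ}

include h2 in
/-- **The g-side of the functional equation, per ideal class** (Neukirch VII (8.4)–(8.5) with (7.7): "we recognize the sum in
question as the Gauss sum `τ(χ, g)` … `= χ̄(g)τ(χ)`", in the coset language, for the harmonic weight `σ^m` over an imaginary
quadratic field).  With the data of `sum_grossFinitePart_mul_Λ_eq` and in addition an integral ideal `𝔟' ≠ 0` prime to `𝔪` with
`𝔟𝔟'𝔪𝔡 = (β)`, and `x₁ ∈ 𝔟'`, `x₁ ≡ 1 mod 𝔪`: for `re s > m/2 + 1`,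
`Σ_q χ_f(r_q) Λ̂_{P_q}(s)
   = (2π)^{-s} Γ(s) τ_𝔪(χ_f, b₀x₁/β) h₀ (conj σ(β)^m)⁻¹ |N(β)|^s χ̄(𝔟') 𝔑(𝔟')^{-s} Σ_{𝔞 ∈ [𝔟']⁻¹} χ̄'(𝔞) 𝔑(𝔞)^{-s}`.
[cite: NeukirchANT1999, Ch. VII §8 (8.4)–(8.5) and §7 (7.7)] -/
theorem sum_grossFinitePart_mul_symm_Λ_eq (hψ : HasEmbPowType 𝔪 w.1.embedding m ψ)
    (hprim : IsPrimitiveGross 𝔪 ψ w.1.embedding m) (hm : 1 ≤ m) (h𝔪 : 𝔪 ≠ ⊥)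
    {𝔟 : Ideal (𝓞 K)} (h𝔟 : 𝔟 ≠ ⊥) {b₀ : 𝓞 K} (hb₀ : b₀ ∈ 𝔟)
    {𝔟' : Ideal (𝓞 K)} (h𝔟' : 𝔟' ≠ ⊥) (hcop' : IsCoprime 𝔟' 𝔪) {x₁ : 𝓞 K} (hx₁ : x₁ ∈ 𝔟') (hx₁1 : x₁ - 1 ∈ 𝔪)
    {β : 𝓞 K} (hβ0 : β ≠ 0) (hβ : 𝔟 * 𝔟' * 𝔪 * differentIdeal ℤ (𝓞 K) = Ideal.span {β})
    (hy : ((b₀ : K) * x₁ / β) ∈ FractionalIdeal.dual ℤ ℚ (𝔪 : FractionalIdeal (𝓞 K)⁰ K))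
    {N : ℕ} (hN0 : N ≠ 0) [Fintype (𝓞 K ⧸ 𝔪)] {s : ℂ} (hs : (m : ℝ) / 2 + 1 < s.re) :
    ∑ q : 𝓞 K ⧸ 𝔪, grossFinitePart K 𝔪 ψ w.1.embedding m (liftNZ K 𝔪 q) *
        (NumberField.heckeThetaPairC K w h2 hm (Units.mk0 _ (coeIdeal_mul_ne_zero h𝔪 h𝔟))
          ((liftNZ K 𝔪 q : K) * b₀)).symm.Λ s =
      (2 * Real.pi : ℂ) ^ (-s) * Complex.Gamma s *
        grossGaussSum K 𝔪 ψ w.1.embedding m ((b₀ : K) * x₁ / β) * (orbitMult K N : ℂ) *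
        (starRingEnd ℂ (w.1.embedding (β : K)) ^ m)⁻¹ *
        (((|(Algebra.norm ℚ (β : K) : ℚ)| : ℝ)) : ℂ) ^ s *
        starRingEnd ℂ (idealPow K ψ 𝔟') * ((Ideal.absNorm 𝔟' : ℕ) : ℂ) ^ (-s) *
        ∑' 𝔞 : classImage ((𝔟' : Ideal (𝓞 K)) : FractionalIdeal (𝓞 K)⁰ K),
          rayClassCoeff 𝔪 (star ψ) 𝔞 * ((Ideal.absNorm (𝔞 : Ideal (𝓞 K)) : ℕ) : ℂ) ^ (-s) := by
  classical
  set σ := w.1.embedding with hσdef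
  set r : 𝓞 K ⧸ 𝔪 → 𝓞 K := liftNZ K 𝔪 with hr
  have hσ' : 1 < s.re - (m : ℝ) / 2 := by linarith
  have hβK : ((β : 𝓞 K) : K) ≠ 0 := by exact_mod_cast hβ0
  have hσβ : starRingEnd ℂ (σ (β : K)) ^ m ≠ 0 :=
    pow_ne_zero _ (by rw [map_ne_zero]; exact (map_ne_zero σ).mpr hβK)
  obtain ⟨hId1, hId2⟩ := dual_coeIdeal_mul_eq_of_span_eq h𝔪 h𝔟 h𝔟' hβ0 hβ
  set I : (FractionalIdeal (𝓞 K)⁰ K)ˣ := Units.mk0 _ (coeIdeal_mul_ne_zero h𝔪 h𝔟) with hI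
  have hIval : (I : FractionalIdeal (𝓞 K)⁰ K) = (((𝔪 * 𝔟 : Ideal (𝓞 K)) : FractionalIdeal (𝓞 K)⁰ K)) := by
    rw [hI, Units.val_mk0]
  set B : FractionalIdeal (𝓞 K)⁰ K := FractionalIdeal.dual ℤ ℚ (I : FractionalIdeal (𝓞 K)⁰ K) with hB
  have hBeq : B = FractionalIdeal.spanSingleton (𝓞 K)⁰ (β : K)⁻¹ * (𝔟' : FractionalIdeal (𝓞 K)⁰ K) := by
    rw [hB, hIval, hId1]
  have hb0 : (𝔟 : FractionalIdeal (𝓞 K)⁰ K) ≠ 0 := FractionalIdeal.coeIdeal_ne_zero.mpr h𝔟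
  set C : (FractionalIdeal (𝓞 K)⁰ K)ˣ := Units.mk0 (FractionalIdeal.dual ℤ ℚ (𝔟 : FractionalIdeal (𝓞 K)⁰ K))
    (FractionalIdeal.dual_ne_zero ℤ ℚ hb0) with hC
  have hCval : (C : FractionalIdeal (𝓞 K)⁰ K) =
      FractionalIdeal.spanSingleton (𝓞 K)⁰ (β : K)⁻¹ * (((𝔪 * 𝔟' : Ideal (𝓞 K)) : FractionalIdeal (𝓞 K)⁰ K)) := by
    rw [hC, Units.val_mk0, hId2]
  -- the representatives `c_ρ = r_ρ x₁ / β` of `B/C ≅ 𝒪/𝔪`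
  set c : 𝓞 K ⧸ 𝔪 → K := fun ρ ↦ (β : K)⁻¹ * ((r ρ : K) * x₁) with hc
  have hcB : ∀ ρ, c ρ ∈ B := fun ρ ↦ by
    rw [hBeq, hc]
    exact FractionalIdeal.mem_singleton_mul.mpr ⟨(r ρ : K) * x₁,
      FractionalIdeal.mem_coeIdeal_of_mem _ (by simpa using 𝔟'.mul_mem_left (r ρ) hx₁), rfl⟩
  have hCB : (C : FractionalIdeal (𝓞 K)⁰ K) ≤ B := by
    rw [hB, hC, Units.val_mk0, hIval, FractionalIdeal.dual_le_dual ℤ ℚ hb0 (coeIdeal_mul_ne_zero h𝔪 h𝔟)]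
    exact (FractionalIdeal.coeIdeal_le_coeIdeal K).mpr Ideal.mul_le_left
  have hBint : ∀ b ∈ B, ∃ b' : 𝓞 K, b' ∈ 𝔟' ∧ b = (β : K)⁻¹ * b' := by
    intro b hb
    rw [hBeq] at hb
    obtain ⟨t, ht, rfl⟩ := FractionalIdeal.mem_singleton_mul.mp hb
    obtain ⟨b', hb', rfl⟩ := exists_coe_eq_of_mem_coeIdeal ht
    exact ⟨b', hb', rfl⟩
  have hx₁q : Ideal.Quotient.mk 𝔪 x₁ = 1 := by
    rw [← (Ideal.Quotient.mk 𝔪).map_one, Ideal.Quotient.eq]; exact hx₁1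
  have hdiffC : ∀ (b' : 𝓞 K) (_ : b' ∈ 𝔟') (ρ : 𝓞 K ⧸ 𝔪),
      (β : K)⁻¹ * (b' : K) - c ρ ∈ (C : FractionalIdeal (𝓞 K)⁰ K) ↔ Ideal.Quotient.mk 𝔪 b' = ρ := by
    intro b' hb' ρ
    rw [hCval, hc, show (β : K)⁻¹ * (b' : K) - (β : K)⁻¹ * ((r ρ : K) * x₁) = (β : K)⁻¹ * ((b' - r ρ * x₁ : 𝓞 K) : K) by
      push_cast; ring, inv_mul_mem_spanSingleton_inv_mul_iff hβK]
    have hρq : Ideal.Quotient.mk 𝔪 (r ρ * x₁) = ρ := by rw [map_mul, hx₁q, mul_one, hr, mk_liftNZ h𝔪]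
    constructor
    · intro h
      obtain ⟨z, hz, hzK⟩ := exists_coe_eq_of_mem_coeIdeal h
      have hz' : z = b' - r ρ * x₁ := by exact_mod_cast hzK
      rw [hz'] at hz
      rw [← hρq, Ideal.Quotient.eq]
      exact Ideal.mul_le_right hz
    · intro h
      rw [← hρq, Ideal.Quotient.eq] at h
      have h2' : b' - r ρ * x₁ ∈ 𝔟' := 𝔟'.sub_mem hb' (𝔟'.mul_mem_left _ hx₁)
      have : b' - r ρ * x₁ ∈ 𝔪 * 𝔟' := by rw [Ideal.mul_eq_inf_of_isCoprime hcop'.symm]; exact ⟨h, h2'⟩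
      exact FractionalIdeal.mem_coeIdeal_of_mem _ this
  have hint : ∀ x ∈ (C : FractionalIdeal (𝓞 K)⁰ K), ∀ q : 𝓞 K ⧸ 𝔪,
      ∃ n : ℤ, (n : ℚ) = Algebra.trace ℚ K (((r q : K) * b₀) * x) := by
    intro x hx q
    rw [hC, Units.val_mk0] at hx
    obtain ⟨n, hn⟩ := (FractionalIdeal.mem_dual hb0).mp hx ((r q : K) * b₀)
      (FractionalIdeal.mem_coeIdeal_of_mem _ (by simpa using 𝔟.mul_mem_left (r q) hb₀))
    refine ⟨n, ?_⟩
    rw [Algebra.traceForm_apply, mul_comm] at hn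
    exact_mod_cast hn
  -- the box representatives of `B` (= `B ∖ 0`), their integers `b' = β b ∈ 𝔟'` and residues
  have hB0 : B ≠ 0 := by rw [hB]; exact FractionalIdeal.dual_ne_zero ℤ ℚ I.ne_zero
  have hBint' : ∀ x : boxReps B N, ∃ x' : 𝓞 K, x' ∈ 𝔟' ∧ (x : K) = (β : K)⁻¹ * x' := fun x ↦
    hBint x (mem_of_mem_boxReps x.2)
  choose xi hxi𝔟' hxi using hBint'
  have hxi0 : ∀ x, xi x ≠ 0 := fun x h ↦ ne_zero_of_mem_boxReps x.2 (by rw [hxi x, h]; simp)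
  have hxiK : ∀ x, ((xi x : 𝓞 K) : K) = (β : K) * x := fun x ↦ by rw [hxi x]; field_simp
  set ρ' : boxReps B N → 𝓞 K ⧸ 𝔪 := fun x ↦ Ideal.Quotient.mk 𝔪 (xi x) with hρ'
  have hρ'_spec : ∀ (x : boxReps B N) (ρ : 𝓞 K ⧸ 𝔪), (x : K) - c ρ ∈ (C : FractionalIdeal (𝓞 K)⁰ K) ↔ ρ' x = ρ := by
    intro x ρ
    rw [hxi x]
    exact hdiffC (xi x) (hxi𝔟' x) ρ
  -- the weight function and its summability bound
  set hfun : K → ℂ := fun x ↦ starRingEnd ℂ (σ x) ^ m * (((|(Algebra.norm ℚ x : ℚ)| : ℝ) : ℂ) ^ (-s)) with hhfun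
  have hbound : ∀ (x : boxReps B N) (u : ℂ), ‖u‖ ≤ 1 →
      ‖u * hfun x‖ ≤ (|(Algebra.norm ℚ (x : K) : ℚ)| : ℝ) ^ (-(s.re - (m : ℝ) / 2)) := by
    intro x u hu
    have hx0 : (x : K) ≠ 0 := ne_zero_of_mem_boxReps x.2
    have hNpos : (0 : ℝ) < (|(Algebra.norm ℚ (x : K) : ℚ)| : ℝ) := by
      exact_mod_cast abs_pos.mpr ((Algebra.norm_ne_zero_iff).mpr hx0)
    rw [norm_mul, hhfun]
    simp only [norm_mul, norm_pow, Complex.norm_conj]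
    have h3 : ‖((|(Algebra.norm ℚ (x : K) : ℚ)| : ℝ) : ℂ) ^ (-s)‖ = (|(Algebra.norm ℚ (x : K) : ℚ)| : ℝ) ^ (-s.re) := by
      rw [Complex.norm_cpow_eq_rpow_re_of_pos hNpos]; simp
    rw [h3, norm_embedding_pow_eq_abs_norm_rpow w h2, show -(s.re - (m : ℝ) / 2) = (m : ℝ) / 2 + -s.re by ring,
      Real.rpow_add hNpos]
    calc ‖u‖ * ((|(Algebra.norm ℚ (x : K) : ℚ)| : ℝ) ^ ((m : ℝ) / 2) * (|(Algebra.norm ℚ (x : K) : ℚ)| : ℝ) ^ (-s.re))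
        ≤ 1 * ((|(Algebra.norm ℚ (x : K) : ℚ)| : ℝ) ^ ((m : ℝ) / 2) * (|(Algebra.norm ℚ (x : K) : ℚ)| : ℝ) ^ (-s.re)) := by
          gcongr
      _ = _ := by ring
  -- Step 1 (G1): the dual Mellin transforms, unfolded and decomposed along the cosets of `C`
  have hΛ : ∀ q, (NumberField.heckeThetaPairC K w h2 hm I ((r q : K) * b₀)).symm.Λ s =
      (2 * Real.pi : ℂ) ^ (-s) * Complex.Gamma s *
        ∑ ρ, (𝐞 (((Algebra.trace ℚ K (((r q : K) * b₀) * c ρ) : ℚ) : ℝ)) : ℂ) *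
          ∑' x : NumberField.pieceReps K ∅ 1 (C : FractionalIdeal (𝓞 K)⁰ K) (c ρ) N, hfun x := by
    intro q
    rw [NumberField.heckeThetaPairC_symm_Λ_eq h2 hm I _ N hs]
    congr 1
    -- the pointwise identity `e(Tr(a₀ b)) = e(Tr(a₀ c_{ρ' b}))` on `B ∖ 0`
    set wq : 𝓞 K ⧸ 𝔪 → ℂ := fun ρ ↦ (𝐞 (((Algebra.trace ℚ K (((r q : K) * b₀) * c ρ) : ℚ) : ℝ)) : ℂ) with hwq
    have hsumq : Summable fun x : boxReps B N ↦ wq (ρ' x) * hfun x := by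
      refine Summable.of_norm_bounded (NumberField.summable_pieceReps_norm_rpow (K := K) ∅ 1 B 0 N hσ') fun x ↦ ?_
      exact hbound x _ (by rw [hwq]; simp only [Circle.norm_coe]; exact le_rfl)
    have hcoll := sum_mul_tsum_pieceReps_eq_tsum_boxReps hCB N c hcB ρ' hρ'_spec wq hfun hsumq
    rw [hcoll]
    refine tsum_congr fun x ↦ ?_
    have hxmemC : (x : K) - c (ρ' x) ∈ (C : FractionalIdeal (𝓞 K)⁰ K) := (hρ'_spec x (ρ' x)).mpr rfl
    obtain ⟨n, hn⟩ := hint _ hxmemC q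
    have heq : (x : K) = c (ρ' x) + ((x : K) - c (ρ' x)) := by ring
    rw [hwq, hhfun]
    simp only
    rw [show ((r q : 𝓞 K) : K) * (b₀ : K) * (x : K) = ((r q : K) * b₀) * c (ρ' x) + ((r q : K) * b₀) * ((x : K) - c (ρ' x)) by ring,
      map_add, ← hn, Rat.cast_add, Rat.cast_intCast, coe_fourierChar_add_int]
    ring
  simp_rw [hΛ]
  -- Step 2 (G2): the Gauss sums `Σ_q χ_f(r_q) e(Tr(r_q b₀ c_ρ)) = τ(r_ρ y₁) = χ̄_f(r_ρ) τ(y₁)`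
  set y₁ : K := (b₀ : K) * x₁ / β with hy₁
  have hgauss : ∀ ρ, ∑ q, grossFinitePart K 𝔪 ψ σ m (r q) *
      (𝐞 (((Algebra.trace ℚ K (((r q : K) * b₀) * c ρ) : ℚ) : ℝ)) : ℂ) =
      starRingEnd ℂ (grossFinitePart K 𝔪 ψ σ m (r ρ)) * grossGaussSum K 𝔪 ψ σ m y₁ := by
    intro ρ
    rw [← grossGaussSum_mul_eq hψ hprim h𝔪 (liftNZ_ne_zero h𝔪 ρ) hy,
      grossGaussSum_eq_sum hψ h𝔪 (coe_mul_mem_dual hy _) r (liftNZ_ne_zero h𝔪) (mk_liftNZ h𝔪)]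
    refine Finset.sum_congr rfl fun q _ ↦ ?_
    rw [grossGaussSummand]
    have : (r q : K) * b₀ * c ρ = (r q : K) * ((r ρ : K) * y₁) := by
      simp only [hc, hy₁]; field_simp
    rw [this]
  have hswap : ∑ q, grossFinitePart K 𝔪 ψ σ m (r q) *
      ((2 * Real.pi : ℂ) ^ (-s) * Complex.Gamma s *
        ∑ ρ, (𝐞 (((Algebra.trace ℚ K (((r q : K) * b₀) * c ρ) : ℚ) : ℝ)) : ℂ) *
          ∑' x : NumberField.pieceReps K ∅ 1 (C : FractionalIdeal (𝓞 K)⁰ K) (c ρ) N, hfun x) =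
      (2 * Real.pi : ℂ) ^ (-s) * Complex.Gamma s * grossGaussSum K 𝔪 ψ σ m y₁ *
        ∑ ρ, starRingEnd ℂ (grossFinitePart K 𝔪 ψ σ m (r ρ)) *
          ∑' x : NumberField.pieceReps K ∅ 1 (C : FractionalIdeal (𝓞 K)⁰ K) (c ρ) N, hfun x := by
    simp_rw [Finset.mul_sum]
    rw [Finset.sum_comm]
    refine Finset.sum_congr rfl fun ρ _ ↦ ?_
    rw [show (2 * Real.pi : ℂ) ^ (-s) * Complex.Gamma s * grossGaussSum K 𝔪 ψ σ m y₁ *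
        (starRingEnd ℂ (grossFinitePart K 𝔪 ψ σ m (r ρ)) *
          ∑' x : NumberField.pieceReps K ∅ 1 (C : FractionalIdeal (𝓞 K)⁰ K) (c ρ) N, hfun x) =
        (2 * Real.pi : ℂ) ^ (-s) * Complex.Gamma s *
          (∑' x : NumberField.pieceReps K ∅ 1 (C : FractionalIdeal (𝓞 K)⁰ K) (c ρ) N, hfun x) *
          (starRingEnd ℂ (grossFinitePart K 𝔪 ψ σ m (r ρ)) * grossGaussSum K 𝔪 ψ σ m y₁) by ring, ← hgauss ρ,
      Finset.mul_sum]
    exact Finset.sum_congr rfl fun q _ ↦ by ring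
  rw [hswap]
  -- Step 3 (G3): collect the cosets into a sum over `B ∖ 0`
  have hsum : Summable fun x : boxReps B N ↦ starRingEnd ℂ (grossFinitePart K 𝔪 ψ σ m (r (ρ' x))) * hfun x := by
    refine Summable.of_norm_bounded (NumberField.summable_pieceReps_norm_rpow (K := K) ∅ 1 B 0 N hσ') fun x ↦ ?_
    refine hbound x _ ?_
    rw [RCLike.norm_conj]
    exact norm_grossFinitePart_le_one hψ h𝔪 _
  have hcollect := sum_mul_tsum_pieceReps_eq_tsum_boxReps hCB N c hcB ρ' hρ'_spec
    (fun ρ ↦ starRingEnd ℂ (grossFinitePart K 𝔪 ψ σ m (r ρ))) hfun hsum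
  rw [hcollect]
  -- Step 4: the summand only depends on the ideal `x B⁻¹ = (βx) 𝔟'⁻¹`
  have hb0' : (𝔟' : FractionalIdeal (𝓞 K)⁰ K) ≠ 0 := FractionalIdeal.coeIdeal_ne_zero.mpr h𝔟'
  set κβ : ℂ := (starRingEnd ℂ (σ (β : K)) ^ m)⁻¹ with hκβ
  set nβ : ℝ := (|(Algebra.norm ℚ (β : K) : ℚ)| : ℝ) with hnβ
  have hnβpos : 0 < nβ := by
    rw [hnβ]; exact_mod_cast abs_pos.mpr ((Algebra.norm_ne_zero_iff).mpr hβK)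
  set G : classImage B → ℂ := fun 𝔞 ↦ κβ * ((nβ : ℂ) ^ s) * (rayClassCoeff 𝔪 (star ψ) ((𝔞 : Ideal (𝓞 K)) * 𝔟') *
    ((((Ideal.absNorm (𝔞 : Ideal (𝓞 K)) : ℝ) * (Ideal.absNorm 𝔟' : ℝ) : ℝ) : ℂ) ^ (-s))) with hG
  have hpt : ∀ x : boxReps B N, starRingEnd ℂ (grossFinitePart K 𝔪 ψ σ m (r (ρ' x))) * hfun x = G (boxIdealMap B N x) := by
    intro x
    have hx'K : ((xi x : 𝓞 K) : K) ∈ (𝔟' : FractionalIdeal (𝓞 K)⁰ K) :=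
      FractionalIdeal.mem_coeIdeal_of_mem _ (hxi𝔟' x)
    have h1 : grossFinitePart K 𝔪 ψ σ m (r (ρ' x)) = grossFinitePart K 𝔪 ψ σ m (xi x) :=
      grossFinitePart_congr hψ (liftNZ_ne_zero h𝔪 _) (hxi0 x) (by rw [← Ideal.Quotient.eq, hr, mk_liftNZ h𝔪])
    have h2' : Ideal.span {xi x} = (boxIdealMap B N x : Ideal (𝓞 K)) * 𝔟' := by
      rw [span_singleton_eq_eltIdeal_mul h𝔟' hx'K]
      congr 1
      have hγx : (β : K)⁻¹ * (xi x : K) ∈ FractionalIdeal.spanSingleton (𝓞 K)⁰ (β : K)⁻¹ * (𝔟' : FractionalIdeal (𝓞 K)⁰ K) :=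
        FractionalIdeal.mem_singleton_mul.mpr ⟨_, hx'K, rfl⟩
      rw [← eltIdeal_spanSingleton_mul (inv_ne_zero hβK) hx'K hγx]
      change eltIdeal _ _ _ = eltIdeal B x (mem_of_mem_boxReps x.2)
      exact eltIdeal_congr' hBeq.symm hγx (mem_of_mem_boxReps x.2) (hxi x).symm
    -- conjugate weights: `conj σ(x)^m = conj σ(x')^m · (conj σ(β)^m)⁻¹`
    have h3 : starRingEnd ℂ (σ (x : K)) ^ m = starRingEnd ℂ (σ (xi x : K)) ^ m * κβ := by
      rw [hκβ, hxiK x, map_mul, map_mul, mul_pow, mul_comm (starRingEnd ℂ (σ (β : K)) ^ m), mul_assoc,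
        mul_inv_cancel₀ hσβ, mul_one]
    have h4 : (|(Algebra.norm ℚ (x : K) : ℚ)| : ℝ) =
        (Ideal.absNorm (boxIdealMap B N x : Ideal (𝓞 K)) : ℝ) * (Ideal.absNorm 𝔟' : ℝ) * nβ⁻¹ := by
      have := abs_norm_eq_absNorm_eltIdeal_mul hb0' hx'K
      rw [FractionalIdeal.coeIdeal_absNorm] at this
      have hnorm' : (|(Algebra.norm ℚ (xi x : K) : ℚ)| : ℝ) =
          ((Ideal.absNorm (eltIdeal (𝔟' : FractionalIdeal (𝓞 K)⁰ K) (xi x : K) hx'K) : ℚ) : ℝ) * ((Ideal.absNorm 𝔟' : ℚ) : ℝ) := by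
        exact_mod_cast this
      have hideal : eltIdeal (𝔟' : FractionalIdeal (𝓞 K)⁰ K) (xi x : K) hx'K = (boxIdealMap B N x : Ideal (𝓞 K)) := by
        have := h2'
        rw [span_singleton_eq_eltIdeal_mul h𝔟' hx'K] at this
        exact mul_right_cancel₀ h𝔟' this
      rw [hideal] at hnorm'
      have hxn : (|(Algebra.norm ℚ (x : K) : ℚ)| : ℝ) = (|(Algebra.norm ℚ (xi x : K) : ℚ)| : ℝ) * nβ⁻¹ := by
        have hn := congrArg (Algebra.norm ℚ) (hxiK x)
        rw [map_mul] at hn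
        have hnβ0 : (Algebra.norm ℚ (β : K)) ≠ 0 := (Algebra.norm_ne_zero_iff).mpr hβK
        have : Algebra.norm ℚ (x : K) = Algebra.norm ℚ (xi x : K) * (Algebra.norm ℚ (β : K))⁻¹ := by
          rw [hn]; field_simp
        rw [this]; push_cast; rw [abs_mul, abs_inv, hnβ]
      rw [hxn, hnorm']; push_cast; ring
    rw [hhfun]; simp only
    rw [h1, h3, h4, hG]; simp only
    rw [show starRingEnd ℂ (grossFinitePart K 𝔪 ψ σ m (xi x)) *
        (starRingEnd ℂ (σ (xi x : K)) ^ m * κβ *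
          ((((Ideal.absNorm (boxIdealMap B N x : Ideal (𝓞 K)) : ℝ) * (Ideal.absNorm 𝔟' : ℝ) * nβ⁻¹ : ℝ) : ℂ) ^ (-s))) =
        κβ * (starRingEnd ℂ (grossFinitePart K 𝔪 ψ σ m (xi x) * σ (xi x : K) ^ m) *
          ((((Ideal.absNorm (boxIdealMap B N x : Ideal (𝓞 K)) : ℝ) * (Ideal.absNorm 𝔟' : ℝ) * nβ⁻¹ : ℝ) : ℂ) ^ (-s))) by
      rw [map_mul, map_pow]; ring,
      grossFinitePart_mul_pow_eq_rayClassCoeff (hxi0 x), ← rayClassCoeff_star, h2', Complex.ofReal_mul,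
      Complex.mul_cpow_ofReal_nonneg (by positivity) (inv_nonneg.mpr hnβpos.le), Complex.ofReal_inv,
      Complex.inv_cpow _ _ (by
        rw [Complex.arg_ofReal_of_nonneg hnβpos.le]; exact Real.pi_ne_zero.symm), ← Complex.cpow_neg, neg_neg]
    ring
  rw [tsum_congr hpt, tsum_boxReps_eq_orbitMult_mul_tsum hN0 hB0 G (hsum.congr hpt)]
  -- Step 5: `classImage B = classImage 𝔟'` and the simplification of `G`
  have hclass : classImage B = classImage ((𝔟' : Ideal (𝓞 K)) : FractionalIdeal (𝓞 K)⁰ K) := by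
    rw [hBeq]; exact classImage_spanSingleton_mul (inv_ne_zero hβK)
  rw [show ∑' 𝔞 : classImage B, G 𝔞 = ∑' 𝔞 : classImage ((𝔟' : Ideal (𝓞 K)) : FractionalIdeal (𝓞 K)⁰ K),
      κβ * ((nβ : ℂ) ^ s) * (rayClassCoeff 𝔪 (star ψ) ((𝔞 : Ideal (𝓞 K)) * 𝔟') *
        ((((Ideal.absNorm (𝔞 : Ideal (𝓞 K)) : ℝ) * (Ideal.absNorm 𝔟' : ℝ) : ℝ) : ℂ) ^ (-s))) from
    (Equiv.setCongr hclass).tsum_eq (fun 𝔞 ↦ κβ * ((nβ : ℂ) ^ s) * (rayClassCoeff 𝔪 (star ψ) ((𝔞 : Ideal (𝓞 K)) * 𝔟') *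
        ((((Ideal.absNorm (𝔞 : Ideal (𝓞 K)) : ℝ) * (Ideal.absNorm 𝔟' : ℝ) : ℝ) : ℂ) ^ (-s)))) |>.symm ▸ rfl]
  have hterm : ∀ 𝔞 : classImage ((𝔟' : Ideal (𝓞 K)) : FractionalIdeal (𝓞 K)⁰ K),
      κβ * ((nβ : ℂ) ^ s) * (rayClassCoeff 𝔪 (star ψ) ((𝔞 : Ideal (𝓞 K)) * 𝔟') *
        ((((Ideal.absNorm (𝔞 : Ideal (𝓞 K)) : ℝ) * (Ideal.absNorm 𝔟' : ℝ) : ℝ) : ℂ) ^ (-s))) =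
      κβ * ((nβ : ℂ) ^ s) * starRingEnd ℂ (idealPow K ψ 𝔟') * ((Ideal.absNorm 𝔟' : ℕ) : ℂ) ^ (-s) *
        (rayClassCoeff 𝔪 (star ψ) 𝔞 * ((Ideal.absNorm (𝔞 : Ideal (𝓞 K)) : ℕ) : ℂ) ^ (-s)) := by
    intro 𝔞
    rw [rayClassCoeff_mul_of_isCoprime h𝔟' hcop', idealPow_star, Complex.ofReal_mul,
      Complex.mul_cpow_ofReal_nonneg (Nat.cast_nonneg _) (Nat.cast_nonneg _)]
    push_cast
    ring
  rw [tsum_congr hterm, tsum_mul_left]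
  ring

end GSide

end Literature.NumberTheory.LFunctions

end
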